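import Mathlib
import Summits.Ventures.HodgeRepro.Tier4.Common.CongruenceAdeles
import Summits.Ventures.HodgeRepro.Tier4.Common.CompactOpenLevel
import Summits.Ventures.HodgeRepro.Tier4.Line4.FinitePlacePositivity
import Summits.Ventures.HodgeRepro.Tier4.Line4.LevelIndexBound

/-!
# Tier4/Line4/LevelPrimeChoice — a level prime `p` at which a given `γ₀ ∈ G(𝔸_f)` is integral with integral inverse

Blind re-derivation cell `pub-hodge-repro`, Tier 4 «prove the step» (README §9–§10), seat t4-L4-p2 (prover, LINE L4,
gen 4; the «one-line fact» of plan-4 g5 S15355 (1), typed beside `LevelIndexBound` as asked).  Tree path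
`lean/Summits/Ventures/HodgeRepro/Tier4/Line4/LevelPrimeChoice.lean`.  No `def`; no literature.

THE STATEMENT.  For every `γ₀ ∈ G(𝔸)` and every finite set `S` of primes to avoid, there is a prime `p ∉ S` such that at
every place `v ∣ p` all entries of `γ₀` and of `γ₀⁻¹` are `v`-integral (`exists_prime_notMem_integral_above`) — the
hypothesis of the index bound `levelDoubleCoset_measure_le` is met by the CHOICE of the level prime, so the `γ₀`
existence theorem carries no integrality clause (plan-4 S15355 (1)); `exists_prime_levelDoubleCoset_measure_le` is the
two combined: `∃ p ∉ S, p.Prime ∧ ∃ M₁ ≥ 0, ∀ n, μ₀(K(pⁿ) γ₀,f K(pⁿ)).toReal ≤ M₁ · μ₀(K(pⁿ)).toReal`.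

THE PROOF.  A finite adele is integral at cofinitely many places (`finite_setOf_not_le_one`: the restricted-product
condition); a place `v` contains at most ONE rational prime (`subsingleton_setOf_prime_mem`: two distinct primes are
coprime, so `1 ∈ v.asIdeal`); hence the set of primes lying under the finitely many bad places of a finite family of
adeles is finite (`finite_setOf_prime_exists_mem`), and there are infinitely many primes (`Nat.infinite_setOf_prime`).

Nothing here says anything about the status of the Hodge conjecture for CM abelian varieties, which is NOT proved
(HC_CM is NOT proved by anyone in this repository).
-/

set_option autoImplicit false

noncomputable section

namespace Summit.Ventures.HodgeRepro.Tier4.Line4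

open Summit.Ventures.HodgeRepro.Tier4.Common Summit.Ventures.HodgeRepro.Tier4.Line1 MeasureTheory NumberField
  IsDedekindDomain

open scoped ENNReal

section Adeles

variable {k : Type} [Field k] [NumberField k]

/-- A finite adele is integral at all but finitely many places. -/
theorem finite_setOf_not_le_one (x : FiniteAdeleRing (𝓞 k) k) :
    {v : HeightOneSpectrum (𝓞 k) | ¬ Valued.v (x v) ≤ 1}.Finite := by
  have h := x.2
  rw [Filter.eventually_cofinite] at h
  exact h

omit [NumberField k] in
/-- A place contains at most one rational prime. -/
theorem subsingleton_setOf_prime_mem (v : HeightOneSpectrum (𝓞 k)) :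
    {p : ℕ | p.Prime ∧ (p : 𝓞 k) ∈ v.asIdeal}.Subsingleton := by
  rintro p ⟨hp, hpv⟩ q ⟨hq, hqv⟩
  by_contra hne
  have hcop : Nat.Coprime p q := (Nat.coprime_primes hp hq).mpr hne
  have hcopZ : IsCoprime (p : ℤ) (q : ℤ) := Nat.isCoprime_iff_coprime.mpr hcop
  have hcopO : IsCoprime (p : 𝓞 k) (q : 𝓞 k) := by
    have := hcopZ.map (Int.castRingHom (𝓞 k))
    simpa using this
  obtain ⟨a, b, hab⟩ := hcopO
  have h1 : (1 : 𝓞 k) ∈ v.asIdeal := by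
    rw [← hab]
    exact Ideal.add_mem _ (Ideal.mul_mem_left _ _ hpv) (Ideal.mul_mem_left _ _ hqv)
  exact v.isPrime.ne_top ((Ideal.eq_top_iff_one _).mpr h1)

omit [NumberField k] in
/-- The primes lying under a finite set of places form a finite set. -/
theorem finite_setOf_prime_exists_mem {T : Set (HeightOneSpectrum (𝓞 k))} (hT : T.Finite) :
    {p : ℕ | p.Prime ∧ ∃ v ∈ T, (p : 𝓞 k) ∈ v.asIdeal}.Finite := by
  refine (hT.biUnion fun v _ => (subsingleton_setOf_prime_mem v).finite).subset ?_
  rintro p ⟨hp, v, hv, hpv⟩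
  exact Set.mem_iUnion₂.mpr ⟨v, hv, hp, hpv⟩

/-- **Choice of a level prime**: for a finite family of finite adeles and a finite set `S` of primes to avoid, there is
a prime `p ∉ S` such that every member of the family is integral at every place above `p`. -/
theorem exists_prime_notMem_forall_le_one {ι : Type} [Finite ι] (x : ι → FiniteAdeleRing (𝓞 k) k) {S : Set ℕ}
    (hS : S.Finite) :
    ∃ p : ℕ, p.Prime ∧ p ∉ S ∧ ∀ v : HeightOneSpectrum (𝓞 k), (p : 𝓞 k) ∈ v.asIdeal → ∀ i, Valued.v (x i v) ≤ 1 := by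
  set T : Set (HeightOneSpectrum (𝓞 k)) := ⋃ i, {v | ¬ Valued.v (x i v) ≤ 1} with hT
  have hTf : T.Finite := Set.finite_iUnion fun i => finite_setOf_not_le_one (x i)
  have hbad : ({p : ℕ | p.Prime} \ (S ∪ {p : ℕ | p.Prime ∧ ∃ v ∈ T, (p : 𝓞 k) ∈ v.asIdeal})).Nonempty :=
    (Nat.infinite_setOf_prime.sdiff (hS.union (finite_setOf_prime_exists_mem hTf))).nonempty
  obtain ⟨p, hp, hpS⟩ := hbad
  refine ⟨p, hp, fun h => hpS (Or.inl h), fun v hv i => ?_⟩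
  by_contra hi
  exact hpS (Or.inr ⟨hp, v, Set.mem_iUnion.mpr ⟨i, hi⟩, hv⟩)

end Adeles

section Group

variable {k : Type} [Field k] [NumberField k] (W : PlaneData k)

/-- **A level prime for `γ₀`**: for every `γ₀ ∈ G(𝔸)` and finite `S`, some prime `p ∉ S` has `γ₀` and `γ₀⁻¹` integral at
every place above `p` — the hypothesis of `levelDoubleCoset_measure_le`, met by the choice of `p`. -/
theorem exists_prime_notMem_integral_above (γ₀ : GA W) {S : Set ℕ} (hS : S.Finite) :
    ∃ p : ℕ, p.Prime ∧ p ∉ S ∧ ∀ v : HeightOneSpectrum (𝓞 k), (p : 𝓞 k) ∈ v.asIdeal → ∀ i j,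
      Valued.v (finPart k (GA.mat W γ₀ i j) v) ≤ 1 ∧ Valued.v (finPart k (GA.mat W γ₀⁻¹ i j) v) ≤ 1 := by
  obtain ⟨p, hp, hpS, h⟩ := exists_prime_notMem_forall_le_one
    (Sum.elim (fun ij : Fin 4 × Fin 4 => finPart k (GA.mat W γ₀ ij.1 ij.2))
      (fun ij : Fin 4 × Fin 4 => finPart k (GA.mat W γ₀⁻¹ ij.1 ij.2))) hS
  exact ⟨p, hp, hpS, fun v hv i j => ⟨h v hv (Sum.inl (i, j)), h v hv (Sum.inr (i, j))⟩⟩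

/-- The same without an avoided set. -/
theorem exists_prime_integral_above (γ₀ : GA W) :
    ∃ p : ℕ, p.Prime ∧ ∀ v : HeightOneSpectrum (𝓞 k), (p : 𝓞 k) ∈ v.asIdeal → ∀ i j,
      Valued.v (finPart k (GA.mat W γ₀ i j) v) ≤ 1 ∧ Valued.v (finPart k (GA.mat W γ₀⁻¹ i j) v) ≤ 1 := by
  obtain ⟨p, hp, -, h⟩ := exists_prime_notMem_integral_above W γ₀ Set.finite_empty
  exact ⟨p, hp, h⟩

end Group

section Measure

variable {k : Type} [Field k] [NumberField k] (W : PlaneData k) [MeasurableSpace (GA W)] [BorelSpace (GA W)]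

/-- **Level prime + index bound**: for every `γ₀ ∈ G(𝔸_f)`, Haar `μ₀` and finite `S`, there is a prime `p ∉ S` with
`μ₀(K(pⁿ) γ₀ K(pⁿ)).toReal ≤ M₁ · μ₀(K(pⁿ)).toReal` for all `n`, one `M₁ ≥ 0`. -/
theorem exists_prime_levelDoubleCoset_measure_le (μ₀ : Measure (finitePart W)) [μ₀.IsHaarMeasure] {γ₀ : GA W}
    (hγ₀f : γ₀ ∈ finitePart W) {S : Set ℕ} (hS : S.Finite) :
    ∃ p : ℕ, p.Prime ∧ p ∉ S ∧ ∃ M₁ : ℝ, 0 ≤ M₁ ∧ ∀ n : ℕ,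
      (μ₀ {y : finitePart W | (y : GA W) ∈ levelDoubleCoset W (p ^ n) γ₀}).toReal ≤
        M₁ * (μ₀ {y : finitePart W | (y : GA W) ∈ levelK W (p ^ n)}).toReal := by
  obtain ⟨p, hp, hpS, h⟩ := exists_prime_notMem_integral_above W γ₀ hS
  exact ⟨p, hp, hpS, levelDoubleCoset_measure_le W μ₀ hγ₀f p hp (fun v hv i j => (h v hv i j).1)
    (fun v hv i j => (h v hv i j).2)⟩

end Measure

end Summit.Ventures.HodgeRepro.Tier4.Line4

end
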